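import Literature.Barriers.FinalStateConjecture.ExtremalHorizonInstabilityProofs
import HarnessLib

/-!
# Barrier catalogue `FinalStateConjecture`: Aretakis's conservation law along the extremal
# Kerr horizon (`Literature/Barriers/FinalStateConjecture/`, D-0021, D-0014; family `gr`)

`ExtremalHorizonInstabilityProofs.lean` reduces the barrier `AretakisInstability` to the named fact
`Aretakis2015_scalarInstability` (Aretakis, ATMP 19 (2015), Thm. 3, clauses `k = 1, 2`) and defines
Aretakis's charge `aretakisCharge M r₀ ψ = H₀^{Kerr}[ψ]` on the *initial* horizon sphere
`S₀ = {t* = 0} ∩ {r = M}` of the extremal Kerr–Schild chart `Kerr.region M r₀`. The printed proof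
of Thm. 3 rests on two ingredients of very different size: (i) the **conservation of `H₀^{Kerr}`
along `𝓗⁺`** (§5.2 and Prop. 5.1, `l = 0`) — "the source of the above instability results is a
conservation law that holds on `𝓗`" (§1.1) — a computation with the wave operator restricted to
the horizon; and (ii) the decay of axisymmetric solutions (Aretakis, JFA 263 (2012), Thm. 5)
together with "the methods of [aretakis2]" and the projection to the zeroth azimuthal frequency.
This file isolates ingredient (i) (decomposition of the XL fact `Aretakis2015_scalarInstability`,
D-0014):

* `aretakisChargeDensityAt M r₀ ψ τ θ φ*`, `aretakisChargeAt M r₀ ψ τ` — the charge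
  `H₀^{Kerr}[ψ](τ) = ∫_{S_τ} (M sin² θ · Tψ + 4M · Yψ + 2ψ)` on the horizon sphere
  `S_τ = {t* = τ} ∩ {r = M}`, parametrised by `Kerr.extremalHorizonPoint M θ φ* + τ ∂_{t*}`, against
  the induced area element `2M² sin θ dθ dφ*`; at `τ = 0` this is `aretakisCharge`
  (`aretakisChargeAt_zero`);
* the **named fact** `Aretakis2015_chargeConservation`: for every `ψ` of class `C^∞` on an open
  set `U ⊇ {r ≥ M} ∩ {t* ≥ 0}` of the chart with `□_{g_{M,M}} ψ = 0` on `U`,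
  `H₀^{Kerr}[ψ](τ) = H₀^{Kerr}[ψ](0)` for all `τ ≥ 0`.

The class of `ψ` is literally that of `Aretakis2015_scalarInstability` (no localisation or
axisymmetry is needed for the conservation law), so that the fact composes with it. Discharging
`Aretakis2015_chargeConservation` is a calculus task on the explicit Kerr–Schild components
(`Kerr.dalembertian_eq_divergence`): the divergence `∑_μ ∂_μ g^{μν} = −(2M/Σ) ℓ^ν` of the inverse
Kerr–Schild metric, the inverse metric at `r = M` in the frame `(∂_v, ∂_r, ∂_θ, ∂_φ*)`, and an
integration by parts on the sphere; it is planned in this file (append protocol).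

## Rendering (design)

* *Sections.* Aretakis's `S_τ` are the sections `{v = τ}` of `𝓗⁺ = {r = M}` in ingoing coordinates
  `(v, r, θ, φ*)`; on `𝓗⁺`, `v = t* + M`, so they are the chart sections `Kerr.horizonSection M M r₀ τ'`,
  `τ' = τ − M`, and conservation along `𝓗⁺` is insensitive to the shift. The point of `S_τ` with
  angles `(θ, φ*)` is `Kerr.extremalHorizonPoint M θ φ* + τ • ∂_{t*}` (`Kerr.radius` and the angles are
  `t*`-independent).
* *Derivatives.* As in `aretakisChargeDensity`: `T = ∂_v = ∂_{t*}` (`E4.basisVector 0`), `Y = ∂_r = ℓ♯`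
  (`Kerr.nullVector M`, the field of `Kerr.transversalDeriv`), applied to the representative
  `Function.extend Subtype.val ψ 0 : E4 → ℝ`, which agrees with `ψ` on the (open) chart, so that at
  points where `ψ` is differentiable these are the manifold derivatives (`OpensChart.mfderiv_eq`).
* *Measure.* `2M² sin θ dθ dφ*` is the area element induced by `g_{M,M}` on every `S_τ`
  (`g_θθ g_φ*φ* = 4M⁴ sin² θ` at `r = M` from the components printed in §5.2; the paper writes
  "`2M sin θ`"); a positive constant factor is immaterial to conservation.
* *What is NOT here.* The hierarchy `H_l^{Kerr}`, `l ≥ 1` (Prop. 5.1), whose coefficients are not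
  printed; the second-order identity behind the `k = 2` blow-up; any decay statement.

## References

* S. Aretakis, *Horizon instability of extremal black holes*, Adv. Theor. Math. Phys. 19 (2015)
  507–530 (arXiv:1206.6598): §1.1, Prop. 3.1 (general conservation law), §5.2 (metric, `□_g`, the
  display defining `H₀^{Kerr}[ψ](τ)` and the sentence "is conserved along `𝓗`"), Prop. 5.1
  (key `Aretakis2015`).
* S. Aretakis, *Decay of axisymmetric solutions of the wave equation on extreme Kerr backgrounds*,
  J. Funct. Anal. 263 (2012) 2770–2831, §2.4 (the same coordinates and `□_g`) (key `Aretakis2012`).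
-/

noncomputable section

open Set Filter
open scoped Manifold ContDiff Topology

namespace Literature.Barriers.FinalStateConjecture

open Literature.Geometry.Lorentzian MeasureTheory

/-! ### The charge on a general horizon section `S_τ` -/

/-- The **density of Aretakis's charge on the horizon sphere `S_τ`** of extremal Kerr in the angular
coordinates `(θ, φ*)`: `(M sin² θ · Tψ + 4M · Yψ + 2ψ)(p_τ(θ, φ*)) · 2M² sin θ` with
`p_τ(θ, φ*) = Kerr.extremalHorizonPoint M θ φ* + τ ∂_{t*}` (the point of `{t* = τ} ∩ {r = M}` with
angles `(θ, φ*)`), `T = ∂_{t*} = ∂_v`, `Y = ℓ♯ = ∂_r` (`Kerr.nullVector`), derivatives of the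
representative `extend ψ 0 : E4 → ℝ`, and `2M² sin θ dθ dφ*` the induced area element. For `τ = 0`
this is `aretakisChargeDensity` (`aretakisChargeDensityAt_zero`). Aretakis, ATMP 19 (2015), §5.2,
the display defining `H₀^{Kerr}[ψ](τ)`. [cite: Aretakis2015, §5.2] -/
def aretakisChargeDensityAt (M r₀ : ℝ) (ψ : Kerr.region M r₀ → ℝ) (τ θ φ : ℝ) : ℝ :=
  (M * Real.sin θ ^ 2 *
      fderiv ℝ (Function.extend Subtype.val ψ 0)
        (Kerr.extremalHorizonPoint M θ φ + τ • E4.basisVector 0) (E4.basisVector 0) +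
    4 * M * fderiv ℝ (Function.extend Subtype.val ψ 0)
        (Kerr.extremalHorizonPoint M θ φ + τ • E4.basisVector 0)
        (Kerr.nullVector M (Kerr.extremalHorizonPoint M θ φ + τ • E4.basisVector 0)) +
    2 * Function.extend Subtype.val ψ 0
        (Kerr.extremalHorizonPoint M θ φ + τ • E4.basisVector 0)) *
  (2 * M ^ 2 * Real.sin θ)

/-- **Aretakis's charge on the horizon sphere `S_τ`**,
`H₀^{Kerr}[ψ](τ) = ∫_{S_τ} (M sin² θ · Tψ + 4M · Yψ + 2ψ)`, as the iterated integral
`∫₀^{2π} ∫₀^π (density) dθ dφ*` of `aretakisChargeDensityAt`. Aretakis, ATMP 19 (2015), §5.2 (the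
display defining `H₀^{Kerr}[ψ](τ)`) and Prop. 5.1. [cite: Aretakis2015, §5.2 and Prop. 5.1] -/
def aretakisChargeAt (M r₀ : ℝ) (ψ : Kerr.region M r₀ → ℝ) (τ : ℝ) : ℝ :=
  ∫ φ in (0 : ℝ)..2 * Real.pi, ∫ θ in (0 : ℝ)..Real.pi, aretakisChargeDensityAt M r₀ ψ τ θ φ

/-- At `τ = 0` the density on `S_τ` is the density on the initial sphere `S₀`. [cite: Aretakis2015, §5.2] -/
@[simp]
theorem aretakisChargeDensityAt_zero (M r₀ : ℝ) (ψ : Kerr.region M r₀ → ℝ) :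
    aretakisChargeDensityAt M r₀ ψ 0 = aretakisChargeDensity M r₀ ψ := by
  funext θ φ
  simp only [aretakisChargeDensityAt, aretakisChargeDensity, zero_smul, add_zero]

/-- At `τ = 0` the charge on `S_τ` is `aretakisCharge` (the charge on `S₀`). [cite: Aretakis2015, §5.2] -/
@[simp]
theorem aretakisChargeAt_zero (M r₀ : ℝ) (ψ : Kerr.region M r₀ → ℝ) :
    aretakisChargeAt M r₀ ψ 0 = aretakisCharge M r₀ ψ := by
  simp only [aretakisChargeAt, aretakisCharge, aretakisChargeDensityAt_zero]

/-- The base point of the density lies on the horizon section `S_τ`: it has Kerr–Schild radius `M`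
and time `t* = τ` (for `M ≥ 0`). [cite: Aretakis2015, §5.2] -/
theorem radius_extremalHorizonPoint_add_smul {M : ℝ} (hM : 0 ≤ M) (θ φ τ : ℝ) :
    Kerr.radius M (Kerr.extremalHorizonPoint M θ φ + τ • E4.basisVector 0) = M ∧
      (Kerr.extremalHorizonPoint M θ φ + τ • E4.basisVector 0) 0 = τ := by
  refine ⟨?_, ?_⟩
  · rw [Kerr.radius_add_smul_basisVector_zero, Kerr.radius_extremalHorizonPoint hM]
  · simp [E4.basisVector]

/-- For `0 < M`, `r₀ < M` the base point of the density lies in the chart `Kerr.region M r₀`, and for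
`τ ≥ 0` in the set `{r ≥ r₊ = M} ∩ {t* ≥ 0}` on which the solutions of the named facts are smooth.
[cite: Aretakis2015, §5.2] -/
theorem extremalHorizonPoint_add_smul_mem {M r₀ : ℝ} (hM : 0 < M) (hr₀ : r₀ < M) (θ φ : ℝ)
    {τ : ℝ} (hτ : 0 ≤ τ) :
    ∃ h : Kerr.extremalHorizonPoint M θ φ + τ • E4.basisVector 0 ∈ Kerr.region M r₀,
      (⟨_, h⟩ : Kerr.region M r₀) ∈
        {x : Kerr.region M r₀ | Kerr.rPlus M M ≤ Kerr.radius M (x : E4) ∧ 0 ≤ (x : E4) 0} := by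
  obtain ⟨hr, ht⟩ := radius_extremalHorizonPoint_add_smul hM.le θ φ τ
  refine ⟨?_, ?_, ?_⟩
  · rw [Kerr.mem_region, hr]
    exact max_lt hr₀ hM
  · show Kerr.rPlus M M ≤ Kerr.radius M (Kerr.extremalHorizonPoint M θ φ + τ • E4.basisVector 0)
    rw [Kerr.rPlus_self, hr]
  · show 0 ≤ (Kerr.extremalHorizonPoint M θ φ + τ • E4.basisVector 0) 0
    rw [ht]
    exact hτ

/-! ### The named fact: conservation of `H₀^{Kerr}` along `𝓗⁺` -/

/-- **Aretakis's conservation law on the extremal Kerr horizon (named fact; §5.2 and Prop. 5.1,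
`l = 0`).** Printed statement (Aretakis, ATMP 19 (2015), §5.2, after the formula for `□_g` in ingoing
coordinates `(v, r, θ, φ*)`, `T = ∂_v`, `Y = ∂_r`): "If `S_τ` are the sections `v = τ` of `𝓗` we then
obtain that the quantity `H₀^{Kerr}[ψ](τ) = ∫_{S_τ} (M sin² θ (Tψ) + 4M (Yψ) + 2ψ)` is conserved along
`𝓗` (note that the volume form of `S_τ` is `2M sin θ dθ dφ*`)", the case `l = 0` of Prop. 5.1: "There
exist constants `α, βᵢ` … which depend only on `M` such that for all solutions `ψ` to the wave equation
on extremal Kerr backgrounds, the quantity `H_l^{Kerr}[ψ](τ) = ∫_{S_τ} (Y^{l+1}ψ_l + α (sin² θ · TY^lψ)_l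
+ ∑ βᵢ Yⁱψ_l)` is conserved along `𝓗`, i.e. it is independent of `τ`"; the general mechanism is
Prop. 3.1 (integrate `g_{VY} · □_g ψ` over `S_τ`; the coefficient of `Yψ` vanishes on `𝓗` by
extremality, `Θ`- and `Φ`-derivatives integrate to zero).
**Vendored form.** For `M > 0`, `0 < r₀ < M`, every open `U` of the chart `Kerr.region M r₀` of extremal
Kerr `g_{M,M}` (`Kerr.smoothMetric M M r₀`, `[Kerr.Facts] [Kerr.SliceFacts]` as in gr.S24) containing
`{r ≥ r₊ = M} ∩ {t* ≥ 0}`, and every `ψ` of class `C^∞` on `U` with `□_g ψ = 0` on `U`: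
`aretakisChargeAt M r₀ ψ τ = aretakisCharge M r₀ ψ` for all `τ ≥ 0` (the chart sections
`S_τ = {t* = τ} ∩ {r = M}` are Aretakis's sections up to the constant shift `v = t* + M` on `𝓗⁺`).
**Deviations, all specialisations or identifications.** (a) The class of `ψ` is that of
`Aretakis2015_scalarInstability` (smooth solutions on a neighbourhood of `{r ≥ M} ∩ {t* ≥ 0}` in the
chart), narrower than "all solutions" but containing every solution arising from regular data on a
hypersurface crossing `𝓗⁺`, restricted to `t* ≥ 0`; only `τ ≥ 0` is asserted. (b) The charge is
normalised with the induced area element `2M² sin θ dθ dφ*` (`aretakisChargeAt`), a constant multiple of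
the printed normalisation. (c) `T`, `Y`, `S_τ` are the Kerr–Schild-chart objects of
`ExtremalHorizonInstability(Proofs).lean` (identifications `T = ∂_{t*}`, `Y = ℓ♯`, argued in those module
docstrings). [cite: Aretakis2015, §5.2 (conservation of H₀^{Kerr}) and Prop. 5.1 (l = 0); Prop. 3.1] -/
def Aretakis2015_chargeConservation : Prop :=
  ∀ [Kerr.Facts] [Kerr.SliceFacts] (M : ℝ), 0 < M → ∀ r₀ ∈ Set.Ioo 0 M,
    ∀ (U : Set (Kerr.region M r₀)) (ψ : Kerr.region M r₀ → ℝ),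
      IsOpen U →
      {x : Kerr.region M r₀ | Kerr.rPlus M M ≤ Kerr.radius M (x : E4) ∧ 0 ≤ (x : E4) 0} ⊆ U →
      ContMDiffOn 𝓘(ℝ, E4) 𝓘(ℝ, ℝ) ∞ ψ U →
      (∀ x ∈ U, (Kerr.smoothMetric M M r₀).toPseudoRiemannianMetric.dalembertian ψ x = 0) →
      ∀ τ : ℝ, 0 ≤ τ → aretakisChargeAt M r₀ ψ τ = aretakisCharge M r₀ ψ

/-- Under the conservation fact the charge is the same on any two sections `S_τ`, `S_τ'`,
`τ, τ' ≥ 0` (unpacking). [cite: Aretakis2015, Prop. 5.1] -/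
theorem Aretakis2015_chargeConservation.chargeAt_eq_chargeAt (h : Aretakis2015_chargeConservation)
    [Kerr.Facts] [Kerr.SliceFacts] {M : ℝ} (hM : 0 < M) {r₀ : ℝ} (hr₀ : r₀ ∈ Set.Ioo 0 M)
    {U : Set (Kerr.region M r₀)} {ψ : Kerr.region M r₀ → ℝ} (hU : IsOpen U)
    (hKU : {x : Kerr.region M r₀ | Kerr.rPlus M M ≤ Kerr.radius M (x : E4) ∧ 0 ≤ (x : E4) 0} ⊆ U)
    (hψ : ContMDiffOn 𝓘(ℝ, E4) 𝓘(ℝ, ℝ) ∞ ψ U)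
    (hsol : ∀ x ∈ U, (Kerr.smoothMetric M M r₀).toPseudoRiemannianMetric.dalembertian ψ x = 0)
    {τ τ' : ℝ} (hτ : 0 ≤ τ) (hτ' : 0 ≤ τ') :
    aretakisChargeAt M r₀ ψ τ = aretakisChargeAt M r₀ ψ τ' := by
  rw [h M hM r₀ hr₀ U ψ hU hKU hψ hsol τ hτ, h M hM r₀ hr₀ U ψ hU hKU hψ hsol τ' hτ']

end Literature.Barriers.FinalStateConjecture

end
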